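import Mathlib
import HarnessLib.Audit
import Summits.PneNP.PneNP.Theorems.PstarNearTruncation
import Summits.PneNP.PneNP.Theorems.PstarCoincidenceLocality
import Summits.PneNP.PneNP.Theorems.PstarMenuCriterion

/-!
# The LOCAL form of branch (A): the census may test near readers only (ROUND-24, O1; memo g26 §63)

FRONTIER range-avoidance ladder, rung F-N3, ROUND 24 (cell `pnp-ideate`, prover-2 memo `g26/O1-LOCALITY-g26.md` §63; typed targets
`PstarCoreBoundTargets.TerminalFive` / `TerminalPeelable` (p646951); census nodes `PstarMenuCriterion.MenuCriterionBound` and its sharp /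
gate-budget restrictions; restricted-model proof complexity — nothing here bears on `P` versus `NP`).

Branch (A) of the census node asks, per clean chord `c` and channel menu `G`, that NO small XOR-closed `K₀ ⊆ J₀ ∖ c` be a terminal core for the
path-sum reader `d₁` (folds `F₁`) and a second reader `d₂` carrying `G ∪ F₂` EXACTLY (`NoSmallPathSumSubcoreExact`).  The second reader may carry
any number of DECORATIONS — monomials with a variable FAR from `(K₀, d₁)` (in no output of `K₀`, not in `C₁`, in no AND slot of a fold of `F₁`) — and
far linear reads.  By `PstarNearTruncation` they are irrelevant to (T3): on the slice the reader equals its NEAR TRUNCATION, and the truncated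
pair plants a `TerminalNC` core inside `K₀` or is unsatisfiable outright.  Hence the census obligation can be stated over LOCAL readers only:

* `far I K₀ d₁` — the variables far from `(K₀, d₁)`;
* **`NoLocalCore I r y J₀ c G`** — for every certificate datum `(K₀, F₁, F₂, t, d₁, d₂)` as in `NoSmallPathSumSubcoreExact`: the LOCAL pair
  `(d₁, d₂^far)` — `d₂` with the far linear reads and every monomial touching a far variable removed — is satisfiable over all assignments AND no
  `M ⊆ K₀` is a `TerminalNC` core for it;
* **`noSmallPathSumSubcoreExact_of_noLocalCore`** — `NoLocalCore c G → NoSmallPathSumSubcoreExact c G` (pure typed expanding instance with simple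
  overlaps): testing local readers on sub-families of `K₀` suffices, for all `k`;
* **`coincidence_trunc`** — branch (B) likewise: an exact coincidence `(Σ_{F₁} p q, (C₂, G₂))` stays a coincidence when the second reader is cut
  down to the monomials and linear reads inside the AND variables of `F₁` (`Φ` := everything else), given `{R₁ = β₁} ≠ ∅`.

What the census reads off: the menu part of `d₂^far` consists of the monomials of `G` with BOTH AND variables near, i.e. inside
`T(K₀) ∪ ANDvars(F₁)` — a bounded alphabet once `(K₀, F₁)` is fixed — and its linear part lies in the near variables too.  Decorations never need
enumerating (their admissibility is `PstarMenuLocality.starSum_pinned` / `PstarMenuRelease.terminal_release`).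
-/

set_option linter.dupNamespace false -- `Summit.PneNP.PneNP.…`: summit = sub-problem name (D-0017 single-conjunct layout)

open Finset Literature.Computability.Complexity
open Summit.PneNP.PneNP.Theorems.PstarTyped (Typed)
open Summit.PneNP.PneNP.Theorems.PstarSALevel (varSet BoundaryExpanding SimpleOverlap)
open Summit.PneNP.PneNP.Theorems.PstarGapOneAll (gval)
open Summit.PneNP.PneNP.Theorems.PstarCoreBound (XorClosed)
open Summit.PneNP.PneNP.Theorems.PstarCoreBoundTargets (Terminal)
open Summit.PneNP.PneNP.Theorems.PstarChordBridgeTools (xpdeg)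
open Summit.PneNP.PneNP.Theorems.PstarUnion (SatPair)
open Summit.PneNP.PneNP.Theorems.PstarUnionCovers (TerminalNC)
open Summit.PneNP.PneNP.Theorems.PstarFibrePolys (bit bit_injective)
open Summit.PneNP.PneNP.Theorems.PstarMenuLocality (pair_unique)
open Summit.PneNP.PneNP.Theorems.PstarNearTruncation (nearMonomials farTerm bit_gval_eq_trunc_add trunc_misses_on_slice exists_near_core)
open Summit.PneNP.PneNP.Theorems.PstarCoincidenceLocality (coincidence_starSum_pinned false_of_far_monomial_coincidence)
open Summit.PneNP.PneNP.Theorems.PstarMenuCriterion (NoSmallPathSumSubcoreExact)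

namespace Summit.PneNP.PneNP.Theorems.PstarLocalCriterion

variable {n m : ℕ}

/-- **The FAR variables of `(K₀, d₁)`**: in no output of `K₀`, not read linearly by `d₁`, in no AND slot of a monomial of `d₁`. -/
def far (I : LocalMap 4 n m) (K₀ : Finset (Fin m)) (d₁ : Finset (Fin n) × Finset (Fin m) × Bool) : Finset (Fin n) :=
  univ.filter fun v => (∀ j ∈ K₀, v ∉ varSet I j) ∧ v ∉ d₁.1 ∧ ∀ f ∈ d₁.2.1, I.vars f 2 ≠ v ∧ I.vars f 3 ≠ v

/-- Membership in `far`. -/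
theorem mem_far (I : LocalMap 4 n m) {K₀ : Finset (Fin m)} {d₁ : Finset (Fin n) × Finset (Fin m) × Bool} {v : Fin n} :
    v ∈ far I K₀ d₁ ↔ (∀ j ∈ K₀, v ∉ varSet I j) ∧ v ∉ d₁.1 ∧ ∀ f ∈ d₁.2.1, I.vars f 2 ≠ v ∧ I.vars f 3 ≠ v := by
  unfold far; rw [mem_filter]; exact and_iff_right (mem_univ v)

/-- **The LOCAL READER** of `d₂` relative to `(K₀, d₁)`: far linear reads and monomials touching a far variable removed. -/
def localReader (I : LocalMap 4 n m) (K₀ : Finset (Fin m)) (d₁ d₂ : Finset (Fin n) × Finset (Fin m) × Bool) :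
    Finset (Fin n) × Finset (Fin m) × Bool :=
  (d₂.1 \ far I K₀ d₁, nearMonomials I d₂.2.1 (far I K₀ d₁), d₂.2.2)

/-- **`NoLocalCore` — BRANCH (A) OVER LOCAL READERS.**  For every certificate datum of `NoSmallPathSumSubcoreExact I r y J₀ c G` the local pair
`(d₁, localReader d₂)` is satisfiable over all assignments and no sub-family `M ⊆ K₀` is a `TerminalNC` core for it. -/
def NoLocalCore (I : LocalMap 4 n m) (r : ℕ) (y : Fin m → Bool) (J₀ : Finset (Fin m)) (c : Fin m) (G : Finset (Fin m)) : Prop :=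
  ∀ K₀ ⊆ J₀.erase c, K₀.Nonempty → XorClosed I K₀ → K₀.card ≤ 5 →
    ∀ (F₁ F₂ : Finset (Fin m)) (t : Bool) (d₁ d₂ : Finset (Fin n) × Finset (Fin m) × Bool),
      F₁ ⊆ (J₀.erase c) \ K₀ → F₂ ⊆ (J₀.erase c) \ K₀ → d₁.2.1 = F₁ → d₂.2.1 = G ∪ F₂ → d₁ ≠ d₂ →
      (∀ v, v ∈ d₁.1 ↔ Odd (xpdeg I (insert c F₁) v)) → (∀ v ∈ d₁.1, ∃ f ∈ K₀, v ∈ varSet I f) →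
      (∀ v ∈ d₂.1, (∃ f ∈ K₀, v ∈ varSet I f) ∨ ∃ g ∈ d₁.2.1 ∪ d₂.2.1, I.vars g 2 = v ∨ I.vars g 3 = v) →
      (∀ z : Fin n → Bool, (∀ f ∈ F₁, I.eval z f = y f) →
        (gval I d₁.1 d₁.2.1 z = d₁.2.2 ↔ xor (z (I.vars c 0)) (z (I.vars c 1)) = t)) →
      (∃ z : Fin n → Bool, gval I d₁.1 d₁.2.1 z = d₁.2.2 ∧
          gval I (localReader I K₀ d₁ d₂).1 (localReader I K₀ d₁ d₂).2.1 z = (localReader I K₀ d₁ d₂).2.2) ∧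
        ∀ M ⊆ K₀, ¬ TerminalNC I r y M d₁ (localReader I K₀ d₁ d₂)

variable {I : LocalMap 4 n m} {r : ℕ} {y : Fin m → Bool} {J₀ : Finset (Fin m)} {c : Fin m} {G : Finset (Fin m)}

/-- **LOCAL READERS SUFFICE FOR BRANCH (A)** (pure typed expanding instance with simple overlaps): `NoLocalCore c G → NoSmallPathSumSubcoreExact c G`. -/
theorem noSmallPathSumSubcoreExact_of_noLocalCore (hI : I.IsPure xorAndPred) (hT : Typed I) (hS : SimpleOverlap I) (hB : BoundaryExpanding r I)
    (h : NoLocalCore I r y J₀ c G) : NoSmallPathSumSubcoreExact I r y J₀ c G := by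
  intro K₀ hK₀ hne hX h5 F₁ F₂ t d₁ d₂ hF₁ hF₂ hm₁ hm₂ hne' hlin hread hread₂ hslice ht
  obtain ⟨hsat, hnoM⟩ := h K₀ hK₀ hne hX h5 F₁ F₂ t d₁ d₂ hF₁ hF₂ hm₁ hm₂ hne' hlin hread hread₂ hslice
  -- the far variables are foreign to the `d₁`-side
  have hΦK : ∀ φ ∈ far I K₀ d₁, ∀ j ∈ K₀, φ ∉ varSet I j := fun φ hφ => ((mem_far I).1 hφ).1
  have hΦC : ∀ φ ∈ far I K₀ d₁, φ ∉ d₁.1 := fun φ hφ => ((mem_far I).1 hφ).2.1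
  have hΦG : ∀ φ ∈ far I K₀ d₁, ∀ g ∈ d₁.2.1, I.vars g 2 ≠ φ ∧ I.vars g 3 ≠ φ := fun φ hφ => ((mem_far I).1 hφ).2.2
  obtain ⟨M, hMK, hM⟩ := exists_near_core hI hT hS hB ht hΦK hΦC hΦG hsat
  exact hnoM M hMK hM

/-- **What the local reader carries**: its monomials are the monomials of `d₂` with both AND variables near — outputs of `K₀`'s variable set,
linear reads of `d₁`, or AND slots of `d₁`'s folds — and its linear part is near. -/
theorem localReader_near (I : LocalMap 4 n m) (K₀ : Finset (Fin m)) (d₁ d₂ : Finset (Fin n) × Finset (Fin m) × Bool) :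
    (∀ v ∈ (localReader I K₀ d₁ d₂).1, v ∉ far I K₀ d₁) ∧
      ∀ g ∈ (localReader I K₀ d₁ d₂).2.1, g ∈ d₂.2.1 ∧ I.vars g 2 ∉ far I K₀ d₁ ∧ I.vars g 3 ∉ far I K₀ d₁ := by
  unfold localReader
  refine ⟨fun v hv => (mem_sdiff.1 hv).2, fun g hg => ?_⟩
  exact (PstarNearTruncation.mem_nearMonomials I).1 hg

/-! ## Branch (B): local coincidences -/

/-- **AN EXACT COINCIDENCE IS A LOCAL COINCIDENCE.**  `R₁ = Σ_{F₁} p q` and `R₂ = (C₂, G₂)` jointly unsatisfiable everywhere, `{R₁ = β₁} ≠ ∅`, `Φ` a set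
of variables none of which is an AND variable of a member of `F₁` (simple overlaps).  Then `R₁` and the truncation `(C₂ ∖ Φ, nearMonomials G₂ Φ)`
are jointly unsatisfiable as well: on `{R₁ = β₁}` the second reader equals its truncation. -/
theorem coincidence_trunc (hI : I.IsPure xorAndPred) (hS : SimpleOverlap I) {F₁ G₂ : Finset (Fin m)} {C₂ Φ : Finset (Fin n)} {β₁ β₂ : Bool}
    (hU : ∀ z : Fin n → Bool, ¬ (gval I ∅ F₁ z = β₁ ∧ gval I C₂ G₂ z = β₂)) (hA : ∃ z : Fin n → Bool, gval I ∅ F₁ z = β₁)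
    (hΦ : ∀ φ ∈ Φ, ∀ f ∈ F₁, I.vars f 2 ≠ φ ∧ I.vars f 3 ≠ φ) :
    ∀ z : Fin n → Bool, ¬ (gval I ∅ F₁ z = β₁ ∧ gval I (C₂ \ Φ) (nearMonomials I G₂ Φ) z = β₂) := by
  rintro z ⟨hz₁, hz₂⟩
  -- no monomial of `R₂` has both variables in `Φ`
  have hFF : ∀ g ∈ G₂, ¬ (I.vars g 2 ∈ Φ ∧ I.vars g 3 ∈ Φ) := fun g hg ⟨h2, h3⟩ =>
    false_of_far_monomial_coincidence hI hU hg (Or.inl ⟨rfl, rfl⟩) (pair_unique hI hS g) (hΦ _ h2) (hΦ _ h3) hA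
  have h := bit_gval_eq_trunc_add I C₂ hFF z
  have hfar : farTerm I C₂ G₂ Φ z = 0 := by
    unfold PstarNearTruncation.farTerm
    exact sum_eq_zero fun φ hφ => by rw [coincidence_starSum_pinned hI hU (hΦ φ hφ) hz₁, mul_zero]
  rw [hfar, add_zero] at h
  exact hU z ⟨hz₁, by rw [← bit_injective h] at hz₂; exact hz₂⟩

end Summit.PneNP.PneNP.Theorems.PstarLocalCriterion
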